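/-
Copyright (c) 2026 the pub-hodgecm-mathlib formalisation cell (harness21).  Prover seat hodgecm-mathlib-F0P2-p02 (g12), 2026-09-01.  Road «S3-tree» (architect A-p16 (g30)
A-174), the LIFT `_le_one ↦ _le_two`, organ (I) `stub_liftInterior`, N6 «THE ASSEMBLY» (END F0P3a-p03 (g16)) — the two SOCKET ADAPTERS `stub_N3`, `stub_N5b`.
-/
import Literature.NumberTheory.Automorphic.LevelTwoInteriorOrbitalTransport      -- ★ p846692 N3 (F0P2-p01 (g14)): `classOrbitalIntegral_levelOneIndicator_eq_shift`, `isUnit_det_shift_denominators_of_deep`; brings ★ (A3) p846531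
import Literature.NumberTheory.Automorphic.LevelTwoInteriorOrbitalUnfolding      -- ★ (F0P3a-p04 (g17)): `centralizer_eq_of_coe_eq_moebius`, `isUnit_sq_sub_sq_of_apply_eq_toPlace_uniformizer`
import Literature.NumberTheory.Automorphic.UnitaryCarrierCongruenceNhdsBasis     -- ★ p846670 N5b (F0P3a-p06 (g14)): `exists_level_forall_shift_mem_of_mem_nhds_one`
import Literature.NumberTheory.Rogawski1990.LevelTwoLiftInteriorTypeOne         -- ★ p846724 (this seat): `forall_valued_endoEmbLocal_sub_one_le_of_blocks`; brings ★ γ₃ `smul_reindex_add_smul_one`, `smul_fromBlocks_add_smul_one`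
import Literature.NumberTheory.Rogawski1990.DepthZeroKappaTransferTypeTwoGSide  -- ★ p846592: `setOf_entrywise_deep_mem_nhds_one`
import HarnessLib

/-!
# The two socket adapters of the N6 assembly `LevelTwoLiftInterior` (organ (I) of the level-2 lift): N3 in the `σ`-fixed-`c` shape, N5b in the consumer's shape

Topic `NumberTheory/Rogawski1990`; namespace `Literature.NumberTheory.Rogawski1990`.  THEOREMS ONLY (no definition, no instance, no notation, no named fact, no `sorry`); kernel lane
`--supports stmt-HodgeConjecture-24833`.  Cell `pub/hodgecm-mathlib` (D-0151), crux H413; road «S3-tree», the LIFT `_le_one ↦ _le_two`, organ (I) `stub_liftInterior`, N6 «THE ASSEMBLY»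
(END F0P3a-p03 (g16), skeleton `F0/P3a/F0P3a-p03/g16/N6/LevelTwoLiftInterior.skeleton.v1.F0P3ap03g16.lean` sha16 13bbe712dbe20ce0, GREEN modulo its two sockets `stub_N3` :62 and
`stub_N5b` :123; architect A-p16 (g30) A-174 «the two N6 socket adapters»).  The STATEMENTS below are those two socket texts VERBATIM; the proofs are one screen each over the ★
organs of record.  HONEST LABEL: HC_CM is proved only modulo the 2 remaining named inputs (hLiu418 24832, h413 24833) until rung 0 closes; nothing printed is asserted here.

* `classOrbitalIntegral_levelOneIndicator_eq_shift_of_compact` = `stub_N3`: ★ N3 `classOrbitalIntegral_levelOneIndicator_eq_shift` (F0P2-p01 (g14), p846692) asks in addition for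
  `hZ′` (compact centralisers of the matches of the SHIFT `u_H`) and not for `hσc`.  With `σ(c) = c`, `c_w = ϖ_v` and `ι_v(γ_H)_w ≡ 1 (mod ϖ_v²)`: every `y ↔ u_H` is `φ_c(x)`
  for some `x ↔ γ_H` (★ `exists_isLocalNormPair_coe_eq_moebius_of_isLocalNormPair_shift`; `ι_v(u_H) = φ_c(ι_v(γ_H))` ★ `coe_endoEmbLocal_eq_moebius`; the `3 × 3` denominators are
  units ★ `isUnit_det_shift_denominators_of_deep`, `4c` a unit ★ `isUnit_sq_sub_sq_of_apply_eq_toPlace_uniformizer`), and `Z(y) = Z(x)` (★ `centralizer_eq_of_coe_eq_moebius`),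
  so `hZ′` follows from `hZ`.
* `exists_nhds_one_forall_shift_mem` = `stub_N5b`: ★ N5b `exists_level_forall_shift_mem_of_mem_nhds_one` (F0P3a-p06 (g14), p846670) gives a level `j ≥ 1`; take
  `V := {γ_H | g_w ≡ 1, u_w ≡ 1 (mod c_w^{j+1})}` (★ `setOf_entrywise_deep_mem_nhds_one`); for `γ_H ∈ V` the Möbius denominators are units (level `j + 1 ≥ 2` ⇒ `ι_v(γ_H)_w` 2-deep
  ★ `forall_valued_endoEmbLocal_sub_one_le_of_blocks` ⇒ ★ `isUnit_det_shift_denominators_of_deep`, then the block determinant), and `u′ = φ_c(u)` as a scalar (★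
  `finGammaTwo_of_coe_eq_moebius`), so N5b applies.

## References
* [Rogawski1990] J. D. Rogawski, *Automorphic Representations of Unitary Groups in Three Variables*, Ann. of Math. Stud. 123 (1990), §4.9 Prop. 4.9.1 (a)(b) pp. 54–55; §4.3
  (4.3.1)–(4.3.2) p. 43.
* [Kottwitz1986] R. E. Kottwitz, *Base change for unit elements of Hecke algebras*, Compositio Math. 60 (1986), §3.
* [Laumon1995] G. Laumon, *Cohomology of Drinfeld Modular Varieties* I (1996), Lemma (5.3.2) p. 136.
* [BernsteinZelevinsky1976] I. N. Bernstein, A. V. Zelevinsky, *Representations of the group GL(n, F) where F is a non-archimedean local field*, Russian Math. Surveys 31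
  (1976), §1.1.
-/

set_option autoImplicit false

noncomputable section

open NumberField IsDedekindDomain MeasureTheory Measure Topology Filter Matrix Polynomial
open scoped MatrixGroups WithZero

namespace Literature.NumberTheory.Rogawski1990

open Literature.NumberTheory.Automorphic Literature.NumberTheory.Automorphic.UnitaryGroup Literature.NumberTheory.Automorphic.MoebiusShift
open Literature.NumberTheory.Automorphic.IntegralReduction
open Literature.NumberTheory.GaloisRepresentations Literature.NumberTheory.NumberFields

/-! ## §1 `stub_N3`: N3 in the `σ`-fixed-`c` shape (the `hZ′` of ★ N3 from `hZ`) -/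

set_option maxHeartbeats 1600000 in
-- the socket statement carries the large CM-place tokens; the proof is one `exact` after the `hZ′` bookkeeping
/-- **N3 IN THE SHAPE OF THE N6 SOCKET `stub_N3`** (END F0P3a-p03 (g16) skeleton 13bbe712 :62 VERBATIM = F0P2-p01 (g14)'s sf 0fd46eb7 :63): LEVEL-TWO INTERIOR ORBITAL TRANSPORT
`Φ(⟦x⟧, 1_{x_w ≡ 1 (ϖ)}·g) = Φ(⟦y⟧, g′)` for `x ↔ γ_H`, `y = φ_c(x)`, at a non-split unramified `v`, `γ_H` `G`-regular 2-deep with compact-centraliser matches, `u_H = φ_c(γ_H)`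
componentwise and `G`-regular, `σ(c) = c`, `c_w = ϖ_v` — by ★ N3 `classOrbitalIntegral_levelOneIndicator_eq_shift`, whose extra binder `hZ′` (compact centralisers of the matches
of `u_H`) follows from `hZ`: every `y′ ↔ u_H` is `φ_c(x′)` with `x′ ↔ γ_H` (★ `exists_isLocalNormPair_coe_eq_moebius_of_isLocalNormPair_shift`) and `Z(y′) = Z(x′)` (★
`centralizer_eq_of_coe_eq_moebius`). [cite: Rogawski1990, §4.9 Prop. 4.9.1 p. 55; §4.3 p. 43] [cite: Kottwitz1986, §3] [cite: Laumon1995, Lemma (5.3.2) p. 136] -/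
theorem classOrbitalIntegral_levelOneIndicator_eq_shift_of_compact (L : Type) [Field L] [NumberField L] [IsCMField L] (H' : Matrix (Fin 3) (Fin 3) L)
    {v : HeightOneSpectrum (𝓞 ↥(maximalRealSubfield L))}
    (hH' : (H'.map (cmConjRingHom L)).transpose = H') (hdet : H'.det ≠ 0) (w : UnitaryGroup.PlacesOver L v)
    (hw : IsCMField.complexConj L • w.1 = w.1) (hv : Algebra.IsUnramifiedIn (𝓞 L) v.asIdeal)
    (h2 : Valued.v (2 : w.1.adicCompletion L) = 1)
    [MeasurableSpace ((cmDatum L 3 H').Local v)] [BorelSpace ((cmDatum L 3 H').Local v)]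
    [∀ γ : ((cmDatum L 3 H').Local v), MeasurableSpace (((cmDatum L 3 H').Local v) ⧸ Subgroup.centralizer ({γ} : Set ((cmDatum L 3 H').Local v)))]
    [∀ γ : ((cmDatum L 3 H').Local v), BorelSpace (((cmDatum L 3 H').Local v) ⧸ Subgroup.centralizer ({γ} : Set ((cmDatum L 3 H').Local v)))]
    (νG : Measure ((cmDatum L 3 H').Local v)) [νG.IsHaarMeasure] [νG.IsMulRightInvariant] {mG : OrbitalMeasureFamily ((cmDatum L 3 H').Local v)}
    (hmG : mG.IsCanonical (fun γ => IsRegularElt (γ.val : GL (Fin 3) (UnitaryGroup.LocalRing L v))) νG)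
    (c : LocalRing L v) (hσc : conjLocal L (IsCMField.complexConj L) v c = c)
    (hcw : c w = toPlace v w (HeckeCharacter.uniformizer ↥(maximalRealSubfield L) v : v.adicCompletion ↥(maximalRealSubfield L)))
    (γH uH : (cmDatum L 2 (Matrix.of fun i j : Fin 2 => if i.val + j.val + 1 = 2 then (1 : L) else 0)).Local v ×
      (cmDatum L 1 (Matrix.of fun i j : Fin 1 => if i.val + j.val + 1 = 1 then (1 : L) else 0)).Local v)
    (hreg : IsLocalGRegular L v γH) (hreg' : IsLocalGRegular L v uH)
    (h1 : ((uH.1.val : GL (Fin 2) (LocalRing L v)).val : Matrix (Fin 2) (Fin 2) (LocalRing L v)) =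
      ((c + 1) • ((γH.1.val : GL (Fin 2) (LocalRing L v)).val : Matrix (Fin 2) (Fin 2) (LocalRing L v)) + (c - 1) • 1) *
        ((c - 1) • ((γH.1.val : GL (Fin 2) (LocalRing L v)).val : Matrix (Fin 2) (Fin 2) (LocalRing L v)) + (c + 1) • 1)⁻¹)
    (h2' : ((uH.2.val : GL (Fin 1) (LocalRing L v)).val : Matrix (Fin 1) (Fin 1) (LocalRing L v)) =
      ((c + 1) • ((γH.2.val : GL (Fin 1) (LocalRing L v)).val : Matrix (Fin 1) (Fin 1) (LocalRing L v)) + (c - 1) • 1) *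
        ((c - 1) • ((γH.2.val : GL (Fin 1) (LocalRing L v)).val : Matrix (Fin 1) (Fin 1) (LocalRing L v)) + (c + 1) • 1)⁻¹)
    (hD1 : IsUnit ((c - 1) • ((γH.1.val : GL (Fin 2) (LocalRing L v)).val : Matrix (Fin 2) (Fin 2) (LocalRing L v)) + (c + 1) • (1 : Matrix (Fin 2) (Fin 2) (LocalRing L v))).det)
    (hD2 : IsUnit ((c - 1) • ((γH.2.val : GL (Fin 1) (LocalRing L v)).val : Matrix (Fin 1) (Fin 1) (LocalRing L v)) + (c + 1) • (1 : Matrix (Fin 1) (Fin 1) (LocalRing L v))).det)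
    (hdeep : ∀ i j, Valued.v (((((endoEmbLocal L v γH).val : GL (Fin 3) (LocalRing L v)).val.map
        (Pi.evalRingHom (fun w' : UnitaryGroup.PlacesOver L v => w'.1.adicCompletion L) w)) - 1) i j) ≤ Valued.v (c w) ^ 2)
    (hZ : ∀ x : (cmDatum L 3 H').Local v, IsLocalNormPair L H' v γH x → CompactSpace (Subgroup.centralizer ({x} : Set ((cmDatum L 3 H').Local v))))
    (g : ((cmDatum L 3 H').Local v) → ℂ) (hg : Rogawski1990.IsLocSmooth g) (hgK : tsupport g ⊆ (cmLocalIntegralLevel L 3 H' v : Set ((cmDatum L 3 H').Local v)))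
    (hginv : ∀ u ∈ cmLocalIntegralLevel L 3 H' v, ∀ x, g (u * x * u⁻¹) = g x)
    (c' : ℕ → ℂ) (hc' : ((∀ x : ((cmDatum L 3 H').Local v), (x ∈ cmLocalIntegralLevel L 3 H' v ∧ (∀ a b, Valued.v (((toPlace v w (HeckeCharacter.uniformizer ↥(maximalRealSubfield L) v : v.adicCompletion ↥(maximalRealSubfield L))) ^ 1)⁻¹ *
        ((((localNonsplitEquiv (IsCMField.complexConj L) H' (IsCMField.complexConj_ne_one L) w hw (x) :
            ↥(unitaryGroupOfForm (galAdicCompletionMap (L := L) (IsCMField.complexConj L) hw) (placeForm H' w.1))) : GL (Fin 3) (w.1.adicCompletion L)) :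
              Matrix (Fin 3) (Fin 3) (w.1.adicCompletion L)) a b - (1 : Matrix (Fin 3) (Fin 3) (w.1.adicCompletion L)) a b)) ≤ 1) ∧
        (redMat ((toPlace v w (HeckeCharacter.uniformizer ↥(maximalRealSubfield L) v : v.adicCompletion ↥(maximalRealSubfield L)))⁻¹ • ((((x).val : GL (Fin 3) (UnitaryGroup.LocalRing L v)).val.map (Pi.evalRingHom (fun w' : UnitaryGroup.PlacesOver L v => w'.1.adicCompletion L) w)) - 1))) ^ 3 = 0 ∧ (redMat ((toPlace v w (HeckeCharacter.uniformizer ↥(maximalRealSubfield L) v : v.adicCompletion ↥(maximalRealSubfield L)))⁻¹ • ((((x).val : GL (Fin 3) (UnitaryGroup.LocalRing L v)).val.map (Pi.evalRingHom (fun w' : UnitaryGroup.PlacesOver L v => w'.1.adicCompletion L) w)) - 1))).rank = 0) → g x = c' 0) ∧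
      (∀ x : ((cmDatum L 3 H').Local v), (x ∈ cmLocalIntegralLevel L 3 H' v ∧ (∀ a b, Valued.v (((toPlace v w (HeckeCharacter.uniformizer ↥(maximalRealSubfield L) v : v.adicCompletion ↥(maximalRealSubfield L))) ^ 1)⁻¹ *
        ((((localNonsplitEquiv (IsCMField.complexConj L) H' (IsCMField.complexConj_ne_one L) w hw (x) :
            ↥(unitaryGroupOfForm (galAdicCompletionMap (L := L) (IsCMField.complexConj L) hw) (placeForm H' w.1))) : GL (Fin 3) (w.1.adicCompletion L)) :
              Matrix (Fin 3) (Fin 3) (w.1.adicCompletion L)) a b - (1 : Matrix (Fin 3) (Fin 3) (w.1.adicCompletion L)) a b)) ≤ 1) ∧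
        (redMat ((toPlace v w (HeckeCharacter.uniformizer ↥(maximalRealSubfield L) v : v.adicCompletion ↥(maximalRealSubfield L)))⁻¹ • ((((x).val : GL (Fin 3) (UnitaryGroup.LocalRing L v)).val.map (Pi.evalRingHom (fun w' : UnitaryGroup.PlacesOver L v => w'.1.adicCompletion L) w)) - 1))) ^ 3 = 0 ∧ (redMat ((toPlace v w (HeckeCharacter.uniformizer ↥(maximalRealSubfield L) v : v.adicCompletion ↥(maximalRealSubfield L)))⁻¹ • ((((x).val : GL (Fin 3) (UnitaryGroup.LocalRing L v)).val.map (Pi.evalRingHom (fun w' : UnitaryGroup.PlacesOver L v => w'.1.adicCompletion L) w)) - 1))).rank = 1) → g x = c' 1) ∧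
      (∀ x : ((cmDatum L 3 H').Local v), (x ∈ cmLocalIntegralLevel L 3 H' v ∧ (∀ a b, Valued.v (((toPlace v w (HeckeCharacter.uniformizer ↥(maximalRealSubfield L) v : v.adicCompletion ↥(maximalRealSubfield L))) ^ 1)⁻¹ *
        ((((localNonsplitEquiv (IsCMField.complexConj L) H' (IsCMField.complexConj_ne_one L) w hw (x) :
            ↥(unitaryGroupOfForm (galAdicCompletionMap (L := L) (IsCMField.complexConj L) hw) (placeForm H' w.1))) : GL (Fin 3) (w.1.adicCompletion L)) :
              Matrix (Fin 3) (Fin 3) (w.1.adicCompletion L)) a b - (1 : Matrix (Fin 3) (Fin 3) (w.1.adicCompletion L)) a b)) ≤ 1) ∧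
        (redMat ((toPlace v w (HeckeCharacter.uniformizer ↥(maximalRealSubfield L) v : v.adicCompletion ↥(maximalRealSubfield L)))⁻¹ • ((((x).val : GL (Fin 3) (UnitaryGroup.LocalRing L v)).val.map (Pi.evalRingHom (fun w' : UnitaryGroup.PlacesOver L v => w'.1.adicCompletion L) w)) - 1))) ^ 3 = 0 ∧ (redMat ((toPlace v w (HeckeCharacter.uniformizer ↥(maximalRealSubfield L) v : v.adicCompletion ↥(maximalRealSubfield L)))⁻¹ • ((((x).val : GL (Fin 3) (UnitaryGroup.LocalRing L v)).val.map (Pi.evalRingHom (fun w' : UnitaryGroup.PlacesOver L v => w'.1.adicCompletion L) w)) - 1))).rank = 2) → g x = c' 2)))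
    (g' : ((cmDatum L 3 H').Local v) → ℂ) (hg' : Rogawski1990.IsLocSmooth g') (hg'K : tsupport g' ⊆ (cmLocalIntegralLevel L 3 H' v : Set ((cmDatum L 3 H').Local v)))
    (hg'inv : ∀ u ∈ cmLocalIntegralLevel L 3 H' v, ∀ x, g' (u * x * u⁻¹) = g' x)
    (hg'val : ∀ k ∈ cmLocalIntegralLevel L 3 H' v,
        (redMat (((k).val : GL (Fin 3) (UnitaryGroup.LocalRing L v)).val.map (Pi.evalRingHom (fun w' : UnitaryGroup.PlacesOver L v => w'.1.adicCompletion L) w)) - 1) ^ 3 = 0 →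
        g' k = c' (redMat (((k).val : GL (Fin 3) (UnitaryGroup.LocalRing L v)).val.map (Pi.evalRingHom (fun w' : UnitaryGroup.PlacesOver L v => w'.1.adicCompletion L) w)) - 1).rank)
    (x y : (cmDatum L 3 H').Local v) (hx : IsLocalNormPair L H' v γH x)
    (hy : ((y.val : GL (Fin 3) (LocalRing L v)).val : Matrix (Fin 3) (Fin 3) (LocalRing L v)) =
      ((c + 1) • ((x.val : GL (Fin 3) (LocalRing L v)).val : Matrix (Fin 3) (Fin 3) (LocalRing L v)) + (c - 1) • 1) *
        ((c - 1) • ((x.val : GL (Fin 3) (LocalRing L v)).val : Matrix (Fin 3) (Fin 3) (LocalRing L v)) + (c + 1) • 1)⁻¹) :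
    classOrbitalIntegral mG ({x : (cmDatum L 3 H').Local v | (∀ a b, Valued.v (((toPlace v w (HeckeCharacter.uniformizer ↥(maximalRealSubfield L) v : v.adicCompletion ↥(maximalRealSubfield L))) ^ 1)⁻¹ *
        ((((localNonsplitEquiv (IsCMField.complexConj L) H' (IsCMField.complexConj_ne_one L) w hw (x) :
            ↥(unitaryGroupOfForm (galAdicCompletionMap (L := L) (IsCMField.complexConj L) hw) (placeForm H' w.1))) : GL (Fin 3) (w.1.adicCompletion L)) :
              Matrix (Fin 3) (Fin 3) (w.1.adicCompletion L)) a b - (1 : Matrix (Fin 3) (Fin 3) (w.1.adicCompletion L)) a b)) ≤ 1)}.indicator g) (ConjClasses.mk x) =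
      classOrbitalIntegral mG g' (ConjClasses.mk y) := by
  -- `|c_w| = exp(−1)`, `4c ∈ E_v^×`, the `3 × 3` denominators of the 2-deep `ι_v(γ_H)`, and `ι_v(u_H) = φ_c(ι_v(γ_H))`
  have hc : Valued.v (c w) = WithZero.exp (-1 : ℤ) := by
    rw [hcw]; exact Liu2021.LemD1IndexedNonVacuityInertCofinite.valued_toPlace_uniformizer_of_isUnramifiedIn L v hv w
  have h4c : IsUnit ((c + 1) ^ 2 - (c - 1) ^ 2) := isUnit_sq_sub_sq_of_apply_eq_toPlace_uniformizer L w hw hcw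
  obtain ⟨hD3, hN3⟩ := isUnit_det_shift_denominators_of_deep L w hw γH hc h2 hdeep
  have hι := coe_endoEmbLocal_eq_moebius L v γH uH c h1 h2' hD1 hD2
  -- `hZ′` from `hZ`
  have hZ' : ∀ y' : (cmDatum L 3 H').Local v, IsLocalNormPair L H' v uH y' →
      CompactSpace (Subgroup.centralizer ({y'} : Set ((cmDatum L 3 H').Local v))) := fun y' hy' => by
    obtain ⟨x', hx', hxy⟩ := exists_isLocalNormPair_coe_eq_moebius_of_isLocalNormPair_shift L v H' c γH uH hσc h4c hι hD3 hy'
    obtain ⟨hDx, -⟩ := isUnit_det_shift_denominators_of_isLocalNormPair L v H' c γH hD3 hN3 hx'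
    haveI := hZ x' hx'
    rw [centralizer_eq_of_coe_eq_moebius L H' x' y' h4c hDx hxy]
    infer_instance
  exact classOrbitalIntegral_levelOneIndicator_eq_shift L H' hH' hdet w hw hv h2 νG hmG c hcw γH uH hreg hreg' h1 h2' hD1 hD2 hdeep hZ hZ' g hg hgK hginv
    c' hc' g' hg' hg'K hg'inv hg'val x y hx hy

/-! ## §2 `stub_N5b`: «`u_H → 1` as `γ_H → 1`» in the consumer's shape -/

set_option maxHeartbeats 800000 in
-- the carriers' types are large
/-- **N5b IN THE SHAPE OF THE N6 SOCKET `stub_N5b`** (END skeleton 13bbe712 :123 VERBATIM): for every `V′ ∈ 𝓝 (1 : H_v)` there is `V ∈ 𝓝 1` such that for `γ_H ∈ V` every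
`u_H` with `u_H = φ_c(γ_H)` on both components lies in `V′` (`|c_w| = exp(−1)`, `|2|_w = 1`).  Proof: ★ N5b `exists_level_forall_shift_mem_of_mem_nhds_one` gives a level
`j ≥ 1`; `V :=` the level-`(j+1)` box (★ `setOf_entrywise_deep_mem_nhds_one`); there the Möbius denominators are units (2-deep `ι_v(γ_H)`: ★ `forall_valued_endoEmbLocal_sub_one_le_of_blocks`,
★ `isUnit_det_shift_denominators_of_deep`, block determinant) and `u′ = φ_c(u)` as a scalar (★ `finGammaTwo_of_coe_eq_moebius`).
[cite: Rogawski1990, §4.9 p. 54; Prop. 4.9.1 p. 55] [cite: Kottwitz1986, §3] [cite: BernsteinZelevinsky1976, §1.1] -/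
theorem exists_nhds_one_forall_shift_mem
    (L : Type) [Field L] [NumberField L] [IsCMField L] {v : HeightOneSpectrum (𝓞 ↥(maximalRealSubfield L))}
    (w : PlacesOver L v) (hw : IsCMField.complexConj L • w.1 = w.1)
    (h2 : Valued.v (2 : w.1.adicCompletion L) = 1)
    {c : LocalRing L v} (hc : Valued.v (c w) = WithZero.exp (-1 : ℤ))
    {V' : Set ((cmDatum L 2 (Matrix.of fun i j : Fin 2 => if i.val + j.val + 1 = 2 then (1 : L) else 0)).Local v × (cmDatum L 1 (Matrix.of fun i j : Fin 1 => if i.val + j.val + 1 = 1 then (1 : L) else 0)).Local v)} (hV' : V' ∈ 𝓝 (1 : ((cmDatum L 2 (Matrix.of fun i j : Fin 2 => if i.val + j.val + 1 = 2 then (1 : L) else 0)).Local v × (cmDatum L 1 (Matrix.of fun i j : Fin 1 => if i.val + j.val + 1 = 1 then (1 : L) else 0)).Local v))) :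
    ∃ V ∈ 𝓝 (1 : ((cmDatum L 2 (Matrix.of fun i j : Fin 2 => if i.val + j.val + 1 = 2 then (1 : L) else 0)).Local v × (cmDatum L 1 (Matrix.of fun i j : Fin 1 => if i.val + j.val + 1 = 1 then (1 : L) else 0)).Local v)), ∀ γH ∈ V, ∀ uH : ((cmDatum L 2 (Matrix.of fun i j : Fin 2 => if i.val + j.val + 1 = 2 then (1 : L) else 0)).Local v × (cmDatum L 1 (Matrix.of fun i j : Fin 1 => if i.val + j.val + 1 = 1 then (1 : L) else 0)).Local v),
      (((uH.1.val : GL (Fin 2) (LocalRing L v)).val : Matrix (Fin 2) (Fin 2) (LocalRing L v)) =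
        ((c + 1) • ((γH.1.val : GL (Fin 2) (LocalRing L v)).val : Matrix (Fin 2) (Fin 2) (LocalRing L v)) + (c - 1) • 1) *
          ((c - 1) • ((γH.1.val : GL (Fin 2) (LocalRing L v)).val : Matrix (Fin 2) (Fin 2) (LocalRing L v)) + (c + 1) • 1)⁻¹) →
      (((uH.2.val : GL (Fin 1) (LocalRing L v)).val : Matrix (Fin 1) (Fin 1) (LocalRing L v)) =
        ((c + 1) • ((γH.2.val : GL (Fin 1) (LocalRing L v)).val : Matrix (Fin 1) (Fin 1) (LocalRing L v)) + (c - 1) • 1) *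
          ((c - 1) • ((γH.2.val : GL (Fin 1) (LocalRing L v)).val : Matrix (Fin 1) (Fin 1) (LocalRing L v)) + (c + 1) • 1)⁻¹) →
      uH ∈ V' := by
  obtain ⟨j, hj, hV⟩ := exists_level_forall_shift_mem_of_mem_nhds_one L w hw hc h2 hV'
  obtain ⟨hc0, hc1, -, -, -, -⟩ := shift_parameter_facts hc
  have hcj0 : (c w) ^ (j + 1) ≠ 0 := pow_ne_zero _ hc0
  refine ⟨_, setOf_entrywise_deep_mem_nhds_one L v w hcj0, fun γH hγ uH h1 h2' => ?_⟩
  obtain ⟨hg, hu⟩ := hγ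
  have hg' : ∀ i k, Valued.v ((((γH.1.val : GL (Fin 2) (LocalRing L v)).val.map (Pi.evalRingHom (fun w' : PlacesOver L v => w'.1.adicCompletion L) w)) - 1) i k) ≤
      Valued.v (c w) ^ (j + 1) := fun i k => by rw [← Valuation.map_pow]; exact hg i k
  have hu' : Valued.v (finGammaTwo L v γH w - 1) ≤ Valued.v (c w) ^ (j + 1) := by rw [← Valuation.map_pow]; exact hu
  -- level `j + 1 ≥ 2` ⇒ `ι_v(γ_H)_w` is 2-deep ⇒ the `3 × 3` denominator is a unit, hence so are its two blocks
  have hp2 : Valued.v (c w) ^ (j + 1) ≤ Valued.v (c w) ^ 2 := pow_le_pow_right_of_le_one' hc1.le (by omega)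
  have hdeep := forall_valued_endoEmbLocal_sub_one_le_of_blocks L v w γH (t := Valued.v (c w) ^ 2) (fun i k => (hg' i k).trans hp2) (hu'.trans hp2)
  obtain ⟨hD3, -⟩ := isUnit_det_shift_denominators_of_deep L w hw γH hc h2 hdeep
  rw [coe_endoEmbLocal, coe_endoGL, smul_reindex_add_smul_one, smul_fromBlocks_add_smul_one, Matrix.det_reindex_self, Matrix.det_fromBlocks_zero₁₂] at hD3
  have hD1 := isUnit_of_mul_isUnit_left hD3
  have hD2 := isUnit_of_mul_isUnit_right hD3
  have hμ₂ : IsUnit ((c - 1) * finGammaTwo L v γH + (c + 1)) := by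
    have e : ((c - 1) • ((γH.2.val : GL (Fin 1) (LocalRing L v)).val : Matrix (Fin 1) (Fin 1) (LocalRing L v)) + (c + 1) • (1 : Matrix (Fin 1) (Fin 1) (LocalRing L v))).det =
        (c - 1) * finGammaTwo L v γH + (c + 1) := by
      rw [Matrix.det_fin_one]
      simp [finGammaTwo, Matrix.one_apply_eq]
    rw [← e]; exact hD2
  exact hV γH uH hg' hu' hD1 hμ₂ h1 (finGammaTwo_of_coe_eq_moebius L v γH uH c h2')

end Literature.NumberTheory.Rogawski1990

end
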